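import Summits.ResolutionOfSingularities.ResolutionOfSingularities.Theorems.SectionAscentFibrewiseClosedPointsTraceIdealBlowup
import Summits.ResolutionOfSingularities.ResolutionOfSingularities.Theorems.SectionAscentFibrewiseClosedPointsTraceIdealSequence
import Literature.AlgebraicGeometry.Resolution.AffineBlowupIntegral
import Literature.AlgebraicGeometry.Resolution.RegularCentreBlowupSeqIntegral
import Literature.AlgebraicGeometry.Resolution.RegularBlowup
import Literature.AlgebraicGeometry.Resolution.BlowupsExistence
import Literature.AlgebraicGeometry.Resolution.BlowupsComposition
import Literature.AlgebraicGeometry.Resolution.AffineBlowupUnique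
import Literature.AlgebraicGeometry.Resolution.IdealSheafLemmas
import Literature.AlgebraicGeometry.Resolution.NonPrincipalLocus
import Literature.AlgebraicGeometry.Resolution.KollarOrderReduction
import Literature.AlgebraicGeometry.Resolution.AlterationsBoundaryDivisor
import Literature.AlgebraicGeometry.Resolution.KollarBlowupSequenceFunctors
import HarnessLib

/-!
# `FibrewiseClosedPoints` — support lemmas: assembly of the untwist (a principalization of
`((a):J)·𝒪` on the regular `Bl_J` yields a one-shot blowing up with centre exactly `Sing`)

Helper lemmas for crux `stmt-ResolutionOfSingularities-15960`
(`Summit.ResolutionOfSingularities.ResolutionOfSingularities.Theses.SectionAscent.FibrewiseClosedPoints`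
≡ `OneShotAffine`), completing the kernel part of the re-centering / trace-ideal-untwist mechanism
(`Cruxes/FibrewiseClosedPoints/ExactCentre.md` §3; ideas `trace-ideal-untwist`,
`admissibilization-class-obstruction`), lead c2, 2026-08-17. With facts (A) `V(τ(J)) = Sing`
(`…TraceIdeal.lean`), (B) `(a)·τ(J) = J·((a):J)` (`…TraceIdealColon.lean`) and Stacks 080A for the
untwist (`…TraceIdealBlowup.lean`):

* `exists_oneShot_of_isBlowup` — **the `OneShot` witness from a principalization.** Let `A` be a
  Noetherian domain, `0 ≠ a ∈ J`, `Bl_J(Spec A)` regular with `J` principal at every regular prime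
  (a strong projective resolution in ideal form). If `q' : Y₁ → Bl_J` is a blowing up along an
  ideal sheaf `𝔟` supported over `Sing(Spec A)`, with `Y₁` regular and `((a):J)·𝒪_{Y₁}`
  invertible (e.g. the composite of a principalization of `((a):J)·𝒪_{Bl_J}` by blowing ups in
  regular centres inside its non-invertible locus, which lies over `Sing` by
  `isPrincipal_map_colon_of_isPrincipal_map` + fact (A)), then `Y₁ ≅ Bl_I(Spec A)` for an ideal
  `I ≠ 0` with `Bl_I` regular and `V(I) = Sing(Spec A)` EXACTLY — the body of the route's
  `OneShot`. Proof: `Y₁ = Bl_{𝔟·((a):J)~}(Bl_J)` (080A with the identity,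
  `IsBlowup.id`) `≅ Bl_{𝔟𝒪}(X'')` for `X'' = Bl_{((a):J)~}(Bl_J)` (080A, uniqueness of blowing
  ups, existence `exists_isBlowup`); `X'' → Spec A` is a blowing up along `τ(J)~`
  (`isBlowup_comp_span_hom`) whose support is `Sing` (fact (A)); Stacks 080B
  (`IsBlowup.exists_isBlowup_comp_supported`) gives a centre `Q = Ĩ` supported in `Sing`;
  `Bl_I ≅ Y₁` is regular, and `V(I) ⊇ Sing` for any regular blowing up
  (`le_of_not_isRegularLocalRing`).
* `isLocallyPrincipalAt_comap_colon` — the untwisting centre `((a):J)~·𝒪_{Bl_J}` is locally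
  principal over `Reg(Spec A)` (fact (D) read on stalks), so the centres of any principalization
  of it lie over `Sing` — the support hypothesis of the assembly.
* `isEffectiveCartier_of_isLocallyPrincipal` — a non-zero locally principal ideal sheaf on an
  integral locally Noetherian scheme is effective Cartier (turns `IsLocallyPrincipal (M.comap σ)`
  of `CossartPiltant2019Principalization` into the hypothesis `hM`).
* `isRegular_of_iso`, `exists_eq_idealSheaf`, `isRegularLocalRing_atPrime_bot` — transport
  lemmas (regularity along isomorphisms; ideal sheaves on `Spec A` are `Ĩ`; the generic point is
  regular).
* `exists_oneShot_of_principalization` — **the same from the tree's named fact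
  `CossartPiltant2019Principalization`** (CP 2019 Prop. 4.3 of arXiv v1) applied to `Bl_J`, given
  that `Bl_J` is Noetherian, excellent and three-dimensional: principalize `((a):J)~·𝒪_{Bl_J}`,
  compose the sequence into one blowing up supported over `Sing`
  (`IsRegularCentreBlowupSeq.exists_isBlowup_support_subset`, `isLocallyPrincipalAt_comap_colon`),
  and apply the assembly.
* `exists_oneShot_of_isBlowup_explicit` — the registered universe-`0`, explicit-binder form.

What remains for the crux's level `d = 3` (threefolds): the `J`-data (CP 2019 Thm 1.1 (i)(ii) +
projectivity over the affine `X`, with Liu 8.1.24, neither yet a tree fact in this form), and the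
routine facts that `Bl_J(Spec A)` is Noetherian, excellent and of dimension three for `A` of finite
type and dimension three over a field.

## Sources
* The Stacks Project, Tags 080A, 080B, 0804. [StacksProject]
* J. Kollár, J. Witaszek, arXiv:2102.03162, Thm 1 and §9 (the normal case, by the dual-sheaf
  device). [KollarWitaszek2021]
* V. Cossart, O. Piltant, J. Algebra 529 (2019) = arXiv:1412.0868, p. 3 (the remark answered
  here for affine `𝒳` of dimension `≤ 3`), Thm 1.1, Prop 4.3 (v1). [CossartPiltant2019]
-/

noncomputable section

set_option linter.dupNamespace false

open AlgebraicGeometry CategoryTheory Literature.AlgebraicGeometry.Resolution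

namespace Summit.ResolutionOfSingularities.ResolutionOfSingularities.Theorems.SectionAscent.TraceIdeal

universe u

variable {A : Type u} [CommRing A]

/-! ## Transport lemmas -/

/-- Regularity of a scheme is invariant under isomorphism (stalks are isomorphic). [folklore] -/
theorem isRegular_of_iso {X Y : Scheme.{u}} (e : X ≅ Y) (hY : Scheme.IsRegular Y) :
    Scheme.IsRegular X := fun x =>
  haveI := hY (e.hom x)
  IsRegularLocalRing.of_ringEquiv (asIso (e.hom.stalkMap x)).commRingCatIsoToRingEquiv

/-- Every ideal sheaf on `Spec A` is the ideal sheaf `Ĩ` of an ideal `I ⊆ A`. [folklore] -/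
theorem exists_eq_idealSheaf (Q : (Spec (.of A)).IdealSheafData) :
    ∃ I : Ideal A, Q = affineBlowup.idealSheaf I := by
  refine ⟨(Q.ideal ⟨⊤, isAffineOpen_top _⟩).map (Scheme.ΓSpecIso (.of A)).hom.hom, ?_⟩
  apply Scheme.IdealSheafData.ext_of_isAffine
  rw [affineBlowup.idealSheaf, ideal_ofIdealTop_top, Ideal.map_map]
  have : ((Scheme.ΓSpecIso (.of A)).inv.hom).comp (Scheme.ΓSpecIso (.of A)).hom.hom =
      RingHom.id _ := by
    ext x
    exact CategoryTheory.Iso.hom_inv_id_apply (Scheme.ΓSpecIso (.of A)) x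
  rw [this, Ideal.map_id]

/-- The generic point of `Spec A` (`A` a domain) is a regular point: `A_{(0)} = Frac A` is a
field. [folklore] -/
theorem isRegularLocalRing_atPrime_bot [IsDomain A] :
    IsRegularLocalRing (Localization.AtPrime (⊥ : Ideal A)) := by
  haveI : IsFractionRing A (Localization.AtPrime (⊥ : Ideal A)) := by
    convert Localization.isLocalization (M := (⊥ : Ideal A).primeCompl) using 2
    ext x; simp [Ideal.primeCompl, mem_nonZeroDivisors_iff_ne_zero]
  letI : Field (Localization.AtPrime (⊥ : Ideal A)) := IsFractionRing.toField A
  infer_instance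


/-- **The untwisting centre is locally principal over the regular locus.** With
`M = ((a):J)` and `hprin` (J principal at regular primes), the inverse image ideal sheaf
`M~·𝒪_{Bl_J}` is locally principal at every point of `Bl_J(Spec A)` lying over a regular point of
`Spec A` (fact (D) `isPrincipal_map_colon_of_isPrincipal_map`, read on the stalk
`𝒪_{Spec A,𝔭} = A_𝔭`, and pulled back). Hence the centres of a principalization of `M~·𝒪_{Bl_J}`
lie over `Sing(Spec A)`. [cite: StacksProject, Tag 01WR] -/
theorem isLocallyPrincipalAt_comap_colon [IsDomain A] [IsNoetherianRing A] (J : Ideal A) {a : A}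
    (haJ : a ∈ J) (ha0 : a ≠ 0)
    (hprin : ∀ 𝔭 : PrimeSpectrum A, IsRegularLocalRing (Localization.AtPrime 𝔭.asIdeal) →
      (J.map (algebraMap A (Localization.AtPrime 𝔭.asIdeal))).IsPrincipal)
    (y : affineBlowup J)
    (hy : IsRegularLocalRing (Localization.AtPrime ((affineBlowup.π J).base y).asIdeal)) :
    IsLocallyPrincipalAt ((affineBlowup.idealSheaf ((Ideal.span {a}).colon (J : Set A))).comap
      (affineBlowup.π J)) y := by
  set M := (Ideal.span {a}).colon (J : Set A)
  set 𝔭 : Spec (.of A) := (affineBlowup.π J).base y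
  have hM : (M.map (algebraMap A (Localization.AtPrime 𝔭.asIdeal))).IsPrincipal :=
    isPrincipal_map_colon_of_isPrincipal_map J haJ ha0 𝔭.asIdeal (hprin 𝔭 hy)
  suffices h𝔭 : IsLocallyPrincipalAt (affineBlowup.idealSheaf M) 𝔭 from h𝔭.comap (affineBlowup.π J)
  apply isLocallyPrincipalAt_of_isPrincipal_stalkIdeal
  letI : Algebra A ((Spec (.of A)).presheaf.stalk 𝔭) := StructureSheaf.stalkAlgebra A 𝔭
  haveI : IsLocalization.AtPrime ((Spec (.of A)).presheaf.stalk 𝔭) 𝔭.asIdeal :=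
    StructureSheaf.IsLocalization.to_stalk A 𝔭
  have hst : stalkIdeal (affineBlowup.idealSheaf M) 𝔭 =
      M.map (algebraMap A ((Spec (.of A)).presheaf.stalk 𝔭)) := by
    rw [affineBlowup.idealSheaf, stalkIdeal_eq_map_germ _ ⟨⊤, isAffineOpen_top _⟩ (Set.mem_univ _),
      Scheme.IdealSheafData.ofIdealTop_ideal, Ideal.map_map, Ideal.map_map]
    congr 1
  rw [hst]
  obtain ⟨g, hg⟩ := hM
  let e := IsLocalization.algEquiv 𝔭.asIdeal.primeCompl (Localization.AtPrime 𝔭.asIdeal)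
    ((Spec (.of A)).presheaf.stalk 𝔭)
  have hcomp : (e.toAlgHom.toRingHom).comp (algebraMap A (Localization.AtPrime 𝔭.asIdeal)) =
      algebraMap A ((Spec (.of A)).presheaf.stalk 𝔭) := by
    ext r
    exact e.commutes r
  have he : M.map (algebraMap A ((Spec (.of A)).presheaf.stalk 𝔭)) =
      (M.map (algebraMap A (Localization.AtPrime 𝔭.asIdeal))).map e.toAlgHom.toRingHom := by
    rw [Ideal.map_map, hcomp]
  rw [he, hg, Ideal.submodule_span_eq, Ideal.map_span, Set.image_singleton]
  exact ⟨⟨_, rfl⟩⟩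


/-- **A non-zero locally principal ideal sheaf on an integral locally Noetherian scheme is an
effective Cartier divisor**: its stalks are principal (`IsLocallyPrincipalAt.isPrincipal_stalkIdeal`)
and non-zero (`stalkIdeal_ne_bot_of_ne_bot`), and on an integral scheme a non-zero generator is a
non-zero-divisor (`isEffectiveCartier_of_stalkIdeal_eq_span_singleton`). This turns the output
`IsLocallyPrincipal (M.comap σ)` of `CossartPiltant2019Principalization` into the hypothesis `hM`
of `exists_oneShot_of_isBlowup`. [cite: StacksProject, Tag 01WS] -/
theorem isEffectiveCartier_of_isLocallyPrincipal {X : Scheme.{u}} [IsIntegral X]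
    [IsLocallyNoetherian X] {I : X.IdealSheafData} (hI : I ≠ ⊥) (h : IsLocallyPrincipal I) :
    IsEffectiveCartier I :=
  isEffectiveCartier_of_stalkIdeal_eq_span_singleton fun x _ => by
    obtain ⟨g, hg⟩ := (h x).isPrincipal_stalkIdeal
    refine ⟨g, fun h0 => stalkIdeal_ne_bot_of_ne_bot hI x ?_, hg⟩
    rw [hg, h0]
    exact Ideal.span_singleton_eq_bot.mpr rfl

/-- **Assembly of the untwist** (`ExactCentre.md` §3 / idea `trace-ideal-untwist`): let `A` be a
Noetherian domain, `0 ≠ a ∈ J`, `Bl_J(Spec A)` regular with `J` principal at regular primes, and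
let `q' : Y₁ → Bl_J` be a blowing up along an ideal sheaf `𝔟` supported over `Sing(Spec A)` such
that `Y₁` is regular and `((a):J)·𝒪_{Y₁}` is invertible (a principalization of the untwisting
centre). Then `Y₁ → Spec A` is the blowing up of an ideal `I` with `V(I) = Sing(Spec A)` exactly:
the `OneShot` witness. Proof: `Y₁ = Bl_{𝔟·((a):J)~}(Bl_J) ≅ Bl_{𝔟𝒪}(Bl_{((a):J)~}(Bl_J))` (080A,
uniqueness), `Bl_{((a):J)~}(Bl_J) → Spec A` is a blowing up along `τ(J)~` with
`V(τ(J)) = Sing` (facts (A), (B)), and Stacks 080B. [cite: StacksProject, Tag 080B] -/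
theorem exists_oneShot_of_isBlowup [IsDomain A] [IsNoetherianRing A] (J : Ideal A) {a : A}
    (haJ : a ∈ J) (ha0 : a ≠ 0) (hreg : Scheme.IsRegular (affineBlowup J))
    (hprin : ∀ 𝔭 : PrimeSpectrum A, IsRegularLocalRing (Localization.AtPrime 𝔭.asIdeal) →
      (J.map (algebraMap A (Localization.AtPrime 𝔭.asIdeal))).IsPrincipal)
    {Y₁ : Scheme.{u}} (q' : Y₁ ⟶ affineBlowup J) (𝔟 : (affineBlowup J).IdealSheafData)
    (hq' : IsBlowup q' 𝔟)
    (h𝔟 : (𝔟.support : Set (affineBlowup J)) ⊆ (affineBlowup.π J).base ⁻¹'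
      {x : Spec (.of A) | ¬ IsRegularLocalRing (Localization.AtPrime x.asIdeal)})
    (hM : IsEffectiveCartier ((((affineBlowup.idealSheaf ((Ideal.span {a}).colon (J : Set A))).comap
      (affineBlowup.π J))).comap q'))
    (hY : Scheme.IsRegular Y₁) :
    ∃ I : Ideal A, I ≠ ⊥ ∧ Scheme.IsRegular (affineBlowup I) ∧
      ∀ 𝔭 : PrimeSpectrum A, I ≤ 𝔭.asIdeal ↔ ¬ IsRegularLocalRing (Localization.AtPrime 𝔭.asIdeal) := by
  classical
  have hJ : J ≠ ⊥ := fun h => ha0 (by rw [h] at haJ; exact (Submodule.mem_bot A).mp haJ)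
  set π := affineBlowup.π J
  set Mt := affineBlowup.idealSheaf ((Ideal.span {a}).colon (J : Set A))
  set τ : Ideal A := Ideal.span {r : A | ∃ (φ : J →ₗ[A] A) (j : J), φ j = r}
  set Sing : Set (Spec (.of A)) := {x | ¬ IsRegularLocalRing (Localization.AtPrime x.asIdeal)}
  -- (1) `X'' = Bl_{Mt}(Bl_J)`, a blowing up of `Spec A` along `τ~`
  obtain ⟨X'', σ, hσ⟩ := exists_isBlowup (affineBlowup J) (Mt.comap π)
  have hX'' : IsBlowup (σ ≫ π) (affineBlowup.idealSheaf τ) :=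
    isBlowup_comp_span_hom J haJ ha0 (affineBlowup.isBlowup J) hσ
  -- (2) `Y₁ → Bl_J` is a blowing up along `𝔟 · Mt~`
  have hY₁ : IsBlowup q' (𝔟 * Mt.comap π) := by
    have := hq'.comp (IsBlowup.id hM)
    rwa [Category.id_comp] at this
  -- (3) so is `Bl_{𝔟𝒪}(X'') → Bl_J`; hence `Y₁ ≅ Bl_{𝔟𝒪}(X'')`
  obtain ⟨Z, ρ, hρ⟩ := exists_isBlowup X'' (𝔟.comap σ)
  have hZ : IsBlowup (ρ ≫ σ) (𝔟 * Mt.comap π) := by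
    rw [mul_comm]; exact hσ.comp hρ
  obtain ⟨e, he, -⟩ := hY₁.unique hZ
  have hq'' : IsBlowup (e.hom ≫ ρ) (𝔟.comap σ) := hρ.iso_comp e
  -- (4) Stacks 080B over `Sing`
  have hτSing : ((affineBlowup.idealSheaf τ).support : Set (Spec (.of A))) ⊆ Sing := by
    rw [affineBlowup.support_idealSheaf]
    intro x hx
    exact (span_hom_le_iff_not_isRegularLocalRing J hJ hreg hprin x).mp
      ((PrimeSpectrum.mem_zeroLocus _ _).mp hx)
  have h𝔟' : ((𝔟.comap σ).support : Set X'') ⊆ (σ ≫ π).base ⁻¹' Sing := by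
    rw [Scheme.IdealSheafData.support_comap]
    intro y hy
    exact h𝔟 hy
  obtain ⟨Q, hQ, hQSing⟩ := IsBlowup.exists_isBlowup_comp_supported (σ ≫ π)
    (affineBlowup.idealSheaf τ) (e.hom ≫ ρ) (𝔟.comap σ) Sing hX'' hτSing hq'' h𝔟'
  have hcomp : (e.hom ≫ ρ) ≫ σ ≫ π = q' ≫ π := by
    rw [Category.assoc, ← Category.assoc ρ σ π, ← Category.assoc, he]
  rw [hcomp] at hQ
  -- (5) `Q = Ĩ`; `Bl_I ≅ Y₁` is regular; `V(I) = Sing`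
  obtain ⟨I, rfl⟩ := exists_eq_idealSheaf Q
  rw [affineBlowup.support_idealSheaf] at hQSing
  have hIle : ∀ 𝔭 : PrimeSpectrum A, I ≤ 𝔭.asIdeal → ¬ IsRegularLocalRing (Localization.AtPrime 𝔭.asIdeal) :=
    fun 𝔭 h => hQSing ((PrimeSpectrum.mem_zeroLocus _ _).mpr h)
  have hI : I ≠ ⊥ := by
    intro hI
    apply hIle ⟨⊥, Ideal.isPrime_bot⟩ ((le_of_eq hI).trans bot_le)
    exact isRegularLocalRing_atPrime_bot
  obtain ⟨e', -, -⟩ := (affineBlowup.isBlowup I).unique hQ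
  have hregI : Scheme.IsRegular (affineBlowup I) := isRegular_of_iso e' hY
  exact ⟨I, hI, hregI, fun 𝔭 => ⟨hIle 𝔭, le_of_not_isRegularLocalRing I hI hregI 𝔭.asIdeal⟩⟩


/-! ## From the named fact `CossartPiltant2019Principalization` -/

/-- **`OneShot` from Cossart–Piltant principalization.** For a Noetherian domain `A`, `0 ≠ a ∈ J`
with `Bl_J(Spec A)` regular and `J` principal at every regular prime (the ideal form of a strong
projective resolution), assume the named fact `CossartPiltant2019Principalization` (CP 2019
Prop. 4.3 of arXiv v1) applies to `Bl_J` — i.e. `Bl_J` is (integral,) Noetherian, excellent and of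
dimension three. Then the `OneShot` body holds for `A`: some non-zero ideal `I` has `Bl_I(Spec A)`
regular and `V(I) = Sing(Spec A)` exactly. (Principalize `((a):J)~·𝒪_{Bl_J}`; its centres lie over
`Sing` by `isLocallyPrincipalAt_comap_colon`; the sequence is one blowing up
(`exists_isBlowup_support_subset`), regular (`IsRegularCentreBlowupSeq.isRegular`), with the
pulled-back centre invertible (`isEffectiveCartier_of_isLocallyPrincipal`); conclude by
`exists_oneShot_of_isBlowup`.) [cite: CossartPiltant2019, Prop. 4.4 (arXiv v1: Prop. 4.3)] -/
theorem exists_oneShot_of_principalization [IsDomain A] [IsNoetherianRing A]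
    (hP : CossartPiltant2019Principalization.{u}) (J : Ideal A) {a : A}
    (haJ : a ∈ J) (ha0 : a ≠ 0) (hreg : Scheme.IsRegular (affineBlowup J))
    (hprin : ∀ 𝔭 : PrimeSpectrum A, IsRegularLocalRing (Localization.AtPrime 𝔭.asIdeal) →
      (J.map (algebraMap A (Localization.AtPrime 𝔭.asIdeal))).IsPrincipal)
    [IsNoetherian (affineBlowup J)] (hexc : Scheme.IsExcellent (affineBlowup J))
    (hdim : topologicalKrullDim (affineBlowup J) = 3) :
    ∃ I : Ideal A, I ≠ ⊥ ∧ Scheme.IsRegular (affineBlowup I) ∧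
      ∀ 𝔭 : PrimeSpectrum A, I ≤ 𝔭.asIdeal ↔ ¬ IsRegularLocalRing (Localization.AtPrime 𝔭.asIdeal) := by
  have hJ : J ≠ ⊥ := fun h => ha0 (by rw [h] at haJ; exact (Submodule.mem_bot A).mp haJ)
  haveI : IsIntegral (affineBlowup J) := affineBlowup.isIntegral hJ
  set π := affineBlowup.π J
  set M := (Ideal.span {a}).colon (J : Set A)
  set Mt := affineBlowup.idealSheaf M
  -- `M~·𝒪_{Bl_J} ≠ 0`
  have haM : a ∈ M := Submodule.mem_colon.mpr fun j _ => Ideal.mul_mem_right _ _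
    (Ideal.mem_span_singleton_self a)
  have hM0 : M ≠ ⊥ := fun h => ha0 (by rw [h] at haM; exact (Submodule.mem_bot A).mp haM)
  have hMt : Mt.comap π ≠ ⊥ := by
    refine (affineBlowup.isBlowup J).comap_ne_bot ?_ (affineBlowup.idealSheaf_ne_bot hM0)
    intro htop
    have hgen : (⟨⊥, Ideal.isPrime_bot⟩ : Spec (.of A)) ∈
        ((affineBlowup.idealSheaf J).support : Set (Spec (.of A))) := by
      rw [htop]; trivial
    rw [affineBlowup.support_idealSheaf] at hgen
    exact hJ (le_bot_iff.mp ((PrimeSpectrum.mem_zeroLocus _ _).mp hgen))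
  -- principalize `M~·𝒪_{Bl_J}` (CP 2019 Prop. 4.3)
  obtain ⟨Y₁, σ, hseq, hlp⟩ := hP (affineBlowup J) hreg hexc hdim (Mt.comap π) hMt
  obtain ⟨𝔟, h𝔟, hsupp⟩ := IsRegularCentreBlowupSeq.exists_isBlowup_support_subset hseq
  have hY : Scheme.IsRegular Y₁ := hseq.isRegular hreg
  obtain ⟨hint, hN, hne⟩ := hseq.isIntegral_and_comap_ne_bot inferInstance inferInstance hMt
  haveI := hint
  haveI := hN
  have hM : IsEffectiveCartier ((Mt.comap π).comap σ) := isEffectiveCartier_of_isLocallyPrincipal hne hlp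
  have h𝔟_supp : (𝔟.support : Set (affineBlowup J)) ⊆
      π.base ⁻¹' {x : Spec (.of A) | ¬ IsRegularLocalRing (Localization.AtPrime x.asIdeal)} := by
    intro y hy hyreg
    exact hsupp hy (isLocallyPrincipalAt_comap_colon J haJ ha0 hprin y hyreg)
  exact exists_oneShot_of_isBlowup J haJ ha0 hreg hprin σ 𝔟 h𝔟 h𝔟_supp hM hY

/-! ## Registered form (universe `0`, explicit binders) -/

/-- **The `OneShot` witness from a principalization** — registered helper of crux
`stmt-ResolutionOfSingularities-15960` (universe `0`, explicit binders; see
`exists_oneShot_of_isBlowup`). [cite: StacksProject, Tag 080B] -/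
theorem exists_oneShot_of_isBlowup_explicit (A : Type) [CommRing A] [IsDomain A]
    [IsNoetherianRing A] (J : Ideal A) (a : A) (haJ : a ∈ J) (ha0 : a ≠ 0)
    (hreg : Literature.AlgebraicGeometry.Resolution.Scheme.IsRegular
    (Literature.AlgebraicGeometry.Resolution.affineBlowup J))
    (hprin : ∀ 𝔭 : PrimeSpectrum A, IsRegularLocalRing (Localization.AtPrime 𝔭.asIdeal) → (J.map
    (algebraMap A (Localization.AtPrime 𝔭.asIdeal))).IsPrincipal)
    (Y₁ : AlgebraicGeometry.Scheme.{0})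
    (q' : Y₁ ⟶ Literature.AlgebraicGeometry.Resolution.affineBlowup J) (𝔟 :
    (Literature.AlgebraicGeometry.Resolution.affineBlowup J).IdealSheafData)
    (hq' : Literature.AlgebraicGeometry.Resolution.IsBlowup q' 𝔟) (h𝔟 : (𝔟.support : Set
    (Literature.AlgebraicGeometry.Resolution.affineBlowup J)) ⊆
    (Literature.AlgebraicGeometry.Resolution.affineBlowup.π J).base ⁻¹' {x : AlgebraicGeometry.Spec
    (CommRingCat.of A) | ¬ IsRegularLocalRing (Localization.AtPrime x.asIdeal)})
    (hM : Literature.AlgebraicGeometry.Resolution.IsEffectiveCartier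
    ((((Literature.AlgebraicGeometry.Resolution.affineBlowup.idealSheaf ((Ideal.span {a}).colon
    (J : Set A))).comap (Literature.AlgebraicGeometry.Resolution.affineBlowup.π J))).comap q'))
    (hY : Literature.AlgebraicGeometry.Resolution.Scheme.IsRegular Y₁) : ∃ I : Ideal A, I ≠ ⊥
      ∧ Literature.AlgebraicGeometry.Resolution.Scheme.IsRegular
    (Literature.AlgebraicGeometry.Resolution.affineBlowup I)
      ∧ ∀ 𝔭 : PrimeSpectrum A, I ≤ 𝔭.asIdeal ↔ ¬ IsRegularLocalRing
    (Localization.AtPrime 𝔭.asIdeal) :=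
  exists_oneShot_of_isBlowup J haJ ha0 hreg hprin q' 𝔟 hq' h𝔟 hM hY

end Summit.ResolutionOfSingularities.ResolutionOfSingularities.Theorems.SectionAscent.TraceIdeal

end
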